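import Literature.NumberTheory.Automorphic.AutomorphicLFunctionFlathProofs
import Literature.NumberTheory.LFunctions.LandauDirichletSeriesQuotient
import HarnessLib

/-!
# Jacquet–Shalika's (5.3.3) off large finite sets: the junction, and the real-quotient input

Trunk `AutomorphicAxiomatic` (G19), topic `NumberTheory/Automorphic`; namespace
`Literature.NumberTheory.Automorphic`. Companion to `SatakeParameterTrivialBound` /
`AutomorphicLFunctionFlathProofs` / `RankinSelbergContinuationGlue` in the decomposition of the named
fact `StandardLFunctionData.multipliable_L` of `AutomorphicLFunction` (Jacquet–Shalika, *On Euler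
products and the classification of automorphic representations I*, Amer. J. Math. **103** (1981),
Thm. (5.3): the standard Euler product of a cuspidal `Π` on `GL_n(𝔸_K)` converges on `re s > 1`).

After `AutomorphicLFunctionFlathProofs` every Jacquet–Shalika fact of the topic rests on the single
named input `JacquetShalika1981_continuation_partialPairL_conj` (Lemma (5.2): `L_S(s, π × π̄)`
continues holomorphically to the *whole* half-plane `re s > 1`), consumed only through the
statement proved from it in `SatakeParameterTrivialBound` (`summable_normSq_trace_finset_of_lemma52'`):

  **(J)** for every cuspidal `Π` there is a finite `S₀` such that for all finite `S ⊇ S₀` and every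
  Satake family `α` of `Π` off `S`, the series (5.3.3) `∑_{v ∉ S} ∑_{k ≥ 1} |tr A_v^k|² / (k q_v^{kσ})`
  converges for every `σ > 1`

— which is (5.3.3)–(5.3.4) of the source *in its printed generality* (loc. cit. p. 556, `S` finite
and large), whereas the named fact `summable_normSq_trace_satakePow` of `AutomorphicLFunctionProofs`
asks it for arbitrary `S`. This file makes **(J)** an explicit junction and feeds it from a weaker
analytic input than Lemma (5.2):

* `summable_normSq_trace_largeFinset` (**named statement (J)**, `def … : Prop`, cited to
  (5.3.3)–(5.3.4)); fed by Lemma (5.2) (`…_of_lemma52`, i.e. `summable_normSq_trace_finset_of_lemma52'`)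
  and by `summable_normSq_trace_satakePow` (`…_of_summable`); and its consequences, proved by the
  arguments of `SatakeParameterTrivialBound` verbatim: `StandardLFunctionData.multipliable_L_of_largeFinset`,
  `absolutelyConvergent_partialStandardL_of_largeFinset`, `multipliable_partialStandardL_of_largeFinset`,
  `StandardLFunctionData.L_eq_partialStandardL_mul_of_largeFinset`, `norm_le_sqrt_of_largeFinset`
  (the Flath input being discharged, `eventually_cofinite_isUnramifiedAt_holds`).
* `JacquetShalika1981_realQuotient_partialPairL_conj` (**named fact**, weaker than Lemma (5.2):
  `JacquetShalika1981_realQuotient_of_continuation`): for `Π`, `S ⊇ S₀`, `α` as above there is an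
  abscissa `x₀` such that for every **real** `σ₀ > 1` some `I`, `A` holomorphic on `re s > 1` satisfy
  `A(σ₀) ≠ 0` and `I = A · L_S(s, α × ᾱ)` on `re s > max(x₀, 1)`. This is the Rankin–Selberg
  quotient representation of the printed proof of Lemma (5.2) (loc. cit. p. 555: `Ψ = A · L_S` with
  `Ψ = ∫ φ' φ E(·, Φ, s)` holomorphic on `re s > 1` by §4 and "given `s₀` we may choose the data so
  that `A(s₀) ≠ 0`") **specialised to real points `s₀ = σ₀`**, where — for `φ' = φ̄` and suitable
  `Φ ≥ 0` — `A(σ₀) > 0` by positivity, so that the local *non-vanishing* results of §1 and §3 of the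
  source are not needed to supply it (the convergence of the local integrals on `re s > 1` still is;
  the sibling file `JacquetShalikaSchurSelfSum` removes that too).
* `summable_normSq_trace_largeFinset_of_realQuotient` (**proved**): the real-quotient input gives
  **(J)**, by the quotient form of Landau's theorem
  (`Literature.NumberTheory.LFunctions.Landau.abscissaOfAbsConv_le_of_exp_quotient`: only
  neighbourhoods of real points of the line of convergence matter) and the proved trivial bound
  (`IsSatakeFamilyOf.norm_le_rpow`, half-plane of absolute convergence `re s > 2n² + 3`); hence
  `StandardLFunctionData.multipliable_L_of_realQuotient` etc.

Resulting dependency graph: `multipliable_L, multipliable_partialStandardL,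
absolutelyConvergent_partialStandardL, L_eq_partialStandardL_mul ⇐ (J) ⇐
JacquetShalika1981_realQuotient_partialPairL_conj ⇐ JacquetShalika1981_continuation_partialPairL_conj`;
the sibling file `JacquetShalikaSchurSelfSum` feeds **(J)** from a purely real-variable input (the
boundedness of the unramified Rankin–Selberg torus sums at real `σ > 1`), with no holomorphy at all.

## References

* H. Jacquet, J. A. Shalika, *On Euler products and the classification of automorphic
  representations I*, Amer. J. Math. 103 (1981), 499–558: Lemma (5.2) p. 554 and its proof p. 555;
  Thm. (5.3) p. 555, proof pp. 555–557 ((5.3.3)–(5.3.4) p. 556); Remark (5.4) p. 557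
  [JacquetShalikaAJM1981].
* J. W. Cogdell, *Analytic theory of L-functions for GL_n*, in: J. Bernstein, S. Gelbart (eds.),
  *An Introduction to the Langlands Program*, Birkhäuser (2004), §2.3 and §4.1
  [CogdellAnalyticTheory2004].
* H. L. Montgomery, R. C. Vaughan, *Multiplicative Number Theory I*, CUP 2007, §1.2, Thm. 1.7
  [MontgomeryVaughan2007].
-/

noncomputable section

open scoped MatrixGroups ComplexConjugate
open NumberField IsDedekindDomain MeasureTheory Complex Filter Topology

namespace Literature.NumberTheory.Automorphic

/-! ### The junction (J): (5.3.3)–(5.3.4) off large finite sets -/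

section Junction

variable {n : ℕ} {K : Type} [Field K] [NumberField K]
  {μ : Measure (AdelicGroupData.gl n K).automorphicQuotient}
  [(AdelicGroupData.gl n K).IsAutomorphicMeasure μ]

/-- **Jacquet–Shalika (1981), (5.3.3)–(5.3.4), in the printed generality (`S` finite and large).**
For every (unitary) cuspidal automorphic representation `Π` of `GL_n(𝔸_K)` there is a finite set `S₀`
of finite places such that for every finite `S ⊇ S₀` and every family `α` of Hecke–Satake parameters
of `Π` off `S` (`IsSatakeFamilyOf`), the series with non-negative terms
`∑_{v ∉ S} ∑_{k ≥ 1} |tr A_v^k|² / (k q_v^{kσ})` (`tr A_v^k = ∑_{a ∈ α v} a^k`) converges for every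
`σ > 1` (loc. cit. proof of Thm. (5.3), p. 556: the Dirichlet series (5.3.3) "converges for
`Re(s) > 1`", (5.3.4), `S` being as in (5.1): finite, containing the ramified places, large). Indexed
by `k : ℕ` for the exponent `k + 1`. The named fact `summable_normSq_trace_satakePow` of
`AutomorphicLFunctionProofs` is the same statement for an arbitrary `S` (it implies this one,
`summable_normSq_trace_largeFinset_of_summable`; conversely this one gives it off the finitely many
unramified places of `S₀`, where the local bound (5.1.3) is needed in addition). Proved from Lemma (5.2)
(`summable_normSq_trace_largeFinset_of_lemma52`), from the weaker real-quotient input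
(`summable_normSq_trace_largeFinset_of_realQuotient`), and from the boundedness of the unramified
Rankin–Selberg torus sums (`JacquetShalikaSchurSelfSum`).
[cite: JacquetShalikaAJM1981, Thm. (5.3), proof, (5.3.3)–(5.3.4), p. 556] -/
def summable_normSq_trace_largeFinset : Prop :=
  ∀ (P : CuspidalAutomorphicRepGL n K μ), ∃ S₀ : Finset (HeightOneSpectrum (𝓞 K)),
    ∀ ⦃S : Finset (HeightOneSpectrum (𝓞 K))⦄ ⦃α : SatakeFamily K⦄, S₀ ⊆ S →
      IsSatakeFamilyOf P ↑S α → ∀ ⦃σ : ℝ⦄, 1 < σ →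
        Summable fun kv : ℕ × {v : HeightOneSpectrum (𝓞 K) // v ∉ (↑S : Set _)} =>
          ‖((α kv.2.1).map (· ^ (kv.1 + 1))).sum‖ ^ 2 /
            ((kv.1 + 1 : ℝ) * (kv.2.1.residueCard : ℝ) ^ ((kv.1 + 1 : ℝ) * σ))

/-- **(J) from Lemma (5.2)**: `summable_normSq_trace_finset_of_lemma52'` of
`SatakeParameterTrivialBound` (Landau's lemma with the proved trivial bound).
[cite: JacquetShalikaAJM1981, Thm. (5.3), proof, (5.3.3)–(5.3.4)] -/
theorem summable_normSq_trace_largeFinset_of_lemma52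
    (h₅₂ : JacquetShalika1981_continuation_partialPairL_conj (μ := μ)) :
    summable_normSq_trace_largeFinset (μ := μ) :=
  fun P => summable_normSq_trace_finset_of_lemma52' h₅₂ P

/-- **(J) from the arbitrary-`S` version** `summable_normSq_trace_satakePow` (take `S₀ = ∅`).
[folklore] -/
theorem summable_normSq_trace_largeFinset_of_summable
    (h : summable_normSq_trace_satakePow (μ := μ)) :
    summable_normSq_trace_largeFinset (μ := μ) :=
  fun P => ⟨∅, fun _ _ _ hα _ hσ => h P hα hσ⟩

/-- **(J) gives (5.1.3) off the large finite sets**: for finite `S ⊇ S₀` and a Satake family `α`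
of `Π` off `S`, `‖a‖ ≤ q_v^{1/2}` for all `a ∈ α v`, `v ∉ S`
(`norm_le_sqrt_of_summable_normSq_trace`: the terms of the convergent series (5.3.3) at every
`σ > 1` bound the power sums, hence the parameters). [cite: JacquetShalikaAJM1981, (5.1.3)] -/
theorem norm_le_sqrt_of_largeFinset (h : summable_normSq_trace_largeFinset (μ := μ))
    (P : CuspidalAutomorphicRepGL n K μ) :
    ∃ S₀ : Finset (HeightOneSpectrum (𝓞 K)), ∀ ⦃S : Finset (HeightOneSpectrum (𝓞 K))⦄
      ⦃α : SatakeFamily K⦄, S₀ ⊆ S → IsSatakeFamilyOf P ↑S α →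
        ∀ v ∉ (↑S : Set (HeightOneSpectrum (𝓞 K))), ∀ a ∈ α v,
          ‖a‖ ≤ Real.sqrt v.residueCard := by
  obtain ⟨S₀, hS₀⟩ := h P
  exact ⟨S₀, fun S α hS hα v hv a ha =>
    norm_le_sqrt_of_summable_normSq_trace (fun σ hσ => hS₀ hS hα hσ) hv ha⟩

/-- **`multipliable_L` from (J)** — Jacquet–Shalika's Thm. (5.3) (case `p = 1`, `π' = 1` of
Remark (5.4)) for the full Euler product of a standard `L`-function datum `D` of a cuspidal `Π`:
enlarge the exceptional set to `S' = D.S ∪ S₀`; off `S'`, (J) gives (5.3.3) for all `σ > 1`, hence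
(5.1.3) (`norm_le_sqrt_of_summable_normSq_trace`) and the absolute convergence of the Satake Euler
product (`multipliable_inv_eulerFactor`); the finitely many factors at `v ∈ S'` are put back
(`Multipliable.mul_compl`). The proof of `StandardLFunctionData.multipliable_L_of_lemma52'`, verbatim,
with (J) for its first line. [cite: JacquetShalikaAJM1981, Thm. (5.3), Remark (5.4)] -/
theorem StandardLFunctionData.multipliable_L_of_largeFinset {P : CuspidalAutomorphicRepGL n K μ}
    (h : summable_normSq_trace_largeFinset (μ := μ)) :
    StandardLFunctionData.multipliable_L (P := P) := by
  classical
  intro D s hs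
  obtain ⟨S₀, hS₀⟩ := h P
  set S' : Finset (HeightOneSpectrum (𝓞 K)) := D.S ∪ S₀ with hS'
  have hsub : (↑D.S : Set (HeightOneSpectrum (𝓞 K))) ⊆ ↑S' := by
    rw [hS', Finset.coe_union]
    exact Set.subset_union_left
  have hα' : IsSatakeFamilyOf P ↑S' D.α := D.isSatakeFamily.mono hsub
  have hsum : ∀ σ : ℝ, 1 < σ →
      Summable fun kv : ℕ × {v : HeightOneSpectrum (𝓞 K) // v ∉ (↑S' : Set _)} =>
        ‖((D.α kv.2.1).map (· ^ (kv.1 + 1))).sum‖ ^ 2 /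
          ((kv.1 + 1 : ℝ) * (kv.2.1.residueCard : ℝ) ^ ((kv.1 + 1 : ℝ) * σ)) :=
    fun σ hσ => hS₀ Finset.subset_union_right hα' hσ
  have hmul := multipliable_inv_eulerFactor (n := n)
    (fun v hv a ha => norm_le_sqrt_of_summable_normSq_trace hsum hv ha)
    (fun v hv => (hα'.card_eq hv).le) hs (hsum s.re hs)
  refine Multipliable.mul_compl (s := (↑S' : Set (HeightOneSpectrum (𝓞 K)))) (S'.multipliable _) ?_
  refine hmul.congr fun v => ?_
  have hv : v.1 ∉ D.S := fun h' => v.2 (hsub (Finset.mem_coe.mpr h'))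
  simp only [Function.comp_apply, D.localFactor_of_not_mem v.1 hv]

/-- **`absolutelyConvergent_partialStandardL` from (J)** (Thm. (5.3) with Remark (5.4), for an
arbitrary exceptional set `S`): enlarge `α` by chosen Satake parameters at the unramified places of
`S` (Flath, discharged: `exists_isSatakeFamilyOf_holds`), apply (J) off `S' = {ramified places} ∪ S₀`,
recover (5.1.3) there and `∑_{v ∉ S'} ‖L(s, Π_v) - 1‖ < ∞` (`summable_norm_inv_eulerFactor_sub_one`),
and pass to `v ∉ S` by adding the finitely many places of `S' ∖ S`
(`summable_compl_of_subset_union_finite`). The proof of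
`absolutelyConvergent_partialStandardL_of_lemma52'`, verbatim, with (J) for its second line.
[cite: JacquetShalikaAJM1981, Thm. (5.3), Remark (5.4)] -/
theorem absolutelyConvergent_partialStandardL_of_largeFinset
    (h : summable_normSq_trace_largeFinset (μ := μ)) :
    absolutelyConvergent_partialStandardL (μ := μ) := by
  classical
  intro P S α hα s hs
  obtain ⟨R, β, -, hβ⟩ := exists_isSatakeFamilyOf_holds (μ := μ) P
  obtain ⟨S₀, hS₀⟩ := h P
  set S' : Finset (HeightOneSpectrum (𝓞 K)) := R ∪ S₀ with hS'
  -- the enlarged family: `α` off `S`, the chosen parameters `β` on `S`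
  let α' : SatakeFamily K := fun v => if v ∈ S then β v else α v
  have hα'S : ∀ v ∉ S, α' v = α v := fun v hv => if_neg hv
  have hα' : IsSatakeFamilyOf P ↑S' α' := by
    intro v hv
    have hvR : v ∉ (↑R : Set _) := fun h' => hv (by
      rw [hS', Finset.coe_union]; exact Or.inl h')
    by_cases hvS : v ∈ S
    · simp only [α', if_pos hvS]
      exact hβ v hvR
    · simp only [α', if_neg hvS]
      exact hα v hvS
  have hsum' : ∀ σ : ℝ, 1 < σ →
      Summable fun kv : ℕ × {v : HeightOneSpectrum (𝓞 K) // v ∉ (↑S' : Set _)} =>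
        ‖((α' kv.2.1).map (· ^ (kv.1 + 1))).sum‖ ^ 2 /
          ((kv.1 + 1 : ℝ) * (kv.2.1.residueCard : ℝ) ^ ((kv.1 + 1 : ℝ) * σ)) :=
    fun σ hσ => hS₀ Finset.subset_union_right hα' hσ
  have hA : Summable fun v : {v : HeightOneSpectrum (𝓞 K) // v ∉ (↑S' : Set _)} =>
      ‖((eulerPolynomial (α' v.1)).eval ((v.1.residueCard : ℂ) ^ (-s)))⁻¹ - 1‖ :=
    summable_norm_inv_eulerFactor_sub_one (n := n)
      (fun v hv a ha => norm_le_sqrt_of_summable_normSq_trace hsum' hv ha)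
      (fun v hv => (hα'.card_eq hv).le) hs (hsum' s.re hs)
  -- transfer from `(S', α')` to `(S, α)`
  have hT : (↑S' : Set (HeightOneSpectrum (𝓞 K))) ⊆ S ∪ (↑S' \ S) := by
    rw [Set.union_sdiff_self]
    exact Set.subset_union_right
  have hmain := summable_compl_of_subset_union_finite
    (g := fun v => ‖((eulerPolynomial (α' v)).eval ((v.residueCard : ℂ) ^ (-s)))⁻¹ - 1‖)
    (S'.finite_toSet.subset Set.sdiff_subset) hT hA
  refine hmain.congr fun v => ?_
  simp only [hα'S v.1 v.2]

/-- Hence **`multipliable_partialStandardL` from (J)**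
(`multipliable_partialStandardL_of_absolutelyConvergent`). [cite: JacquetShalikaAJM1981, Thm. (5.3)] -/
theorem multipliable_partialStandardL_of_largeFinset
    (h : summable_normSq_trace_largeFinset (μ := μ)) :
    multipliable_partialStandardL (μ := μ) :=
  multipliable_partialStandardL_of_absolutelyConvergent
    (absolutelyConvergent_partialStandardL_of_largeFinset h)

/-- Hence the splitting **`L(s, Π) = (∏_{v ∈ S} P_v(q_v^{-s})⁻¹) · L^S(s, Π)` on `re s > 1` from (J)**
(`StandardLFunctionData.L_eq_partialStandardL_mul_of_multipliable_partialStandardL`). [folklore] -/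
theorem StandardLFunctionData.L_eq_partialStandardL_mul_of_largeFinset
    {P : CuspidalAutomorphicRepGL n K μ} (h : summable_normSq_trace_largeFinset (μ := μ)) :
    StandardLFunctionData.L_eq_partialStandardL_mul (P := P) :=
  StandardLFunctionData.L_eq_partialStandardL_mul_of_multipliable_partialStandardL
    (multipliable_partialStandardL_of_largeFinset h)

end Junction

/-! ### The real-quotient input: Landau's lemma only at real points -/

section RealQuotientSeries

variable {K : Type} [Field K] [NumberField K]

/-- **Landau's lemma, quotient form, applied to (5.3.3)** under a bound `|μ_{j,v}| ≤ q_v^B`: if for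
every real `σ₀ > 1` there are `I`, `A` holomorphic on `re s > 1` with `A(σ₀) ≠ 0` and
`I = A · L_S(s, α × ᾱ)` (`partialPairL S α (conjFamily α)`) on `re s > max(x₀, 1)`, then (5.3.3)
converges for every `σ > 1`: the regrouped Dirichlet series over `ℕ` has non-negative coefficients,
abscissa `≤ 2B + 1` and exponential `L_S(s, α × ᾱ)` there
(`partialPairL_conjFamily_eq_exp_LSeries_of_rpow`), so
`Literature.NumberTheory.LFunctions.Landau.abscissaOfAbsConv_le_of_exp_quotient` gives abscissa `≤ 1`
(compare `summable_jsCoeff_mul_rpow_neg_of_continuation_of_rpow` of `SatakeParameterTrivialBound`,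
which needs one function holomorphic on the whole half-plane). [folklore] -/
theorem summable_jsCoeff_mul_rpow_neg_of_realQuotient_of_rpow {S : Set (HeightOneSpectrum (𝓞 K))}
    {α : SatakeFamily K} {n : ℕ} {B : ℝ}
    (hb : ∀ v ∉ S, ∀ a ∈ α v, ‖a‖ ≤ (v.residueCard : ℝ) ^ B)
    (hcard : ∀ v ∉ S, Multiset.card (α v) ≤ n) {x₀ : ℝ}
    (hq : ∀ σ₀ : ℝ, 1 < σ₀ → ∃ I A : ℂ → ℂ, DifferentiableOn ℂ I {s : ℂ | 1 < s.re} ∧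
      DifferentiableOn ℂ A {s : ℂ | 1 < s.re} ∧ A σ₀ ≠ 0 ∧
        ∀ s : ℂ, 1 < s.re → x₀ < s.re → I s = A s * partialPairL S α (conjFamily α) s)
    {σ : ℝ} (hσ : 1 < σ) :
    Summable fun i => jsCoeff S α i * (jsBase S i : ℝ) ^ (-σ) := by
  have h2 := abscissaOfAbsConv_normSqTraceSeries_le_of_rpow hb hcard
  have hax : LSeries.abscissaOfAbsConv (normSqTraceSeries S α) ≤ (max x₀ (2 * B + 1) : ℝ) :=
    h2.trans (by exact_mod_cast le_max_right _ _)
  have h1 : LSeries.abscissaOfAbsConv (normSqTraceSeries S α) ≤ (1 : ℝ) := by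
    refine Literature.NumberTheory.LFunctions.Landau.abscissaOfAbsConv_le_of_exp_quotient
      (normSqTraceSeries_nonneg S α) hax fun σ₀ hσ₀ => ?_
    obtain ⟨I, A, hI, hA, hA0, hIA⟩ := hq σ₀ hσ₀
    refine ⟨I, A, hI, hA, hA0, fun s hs1 hs => ?_⟩
    rw [hIA s hs1 ((le_max_left _ _).trans_lt hs),
      partialPairL_conjFamily_eq_exp_LSeries_of_rpow hb hcard ((le_max_right _ _).trans_lt hs)]
  have hsum : LSeriesSummable (normSqTraceSeries S α) σ := by
    refine LSeriesSummable_of_abscissaOfAbsConv_lt_re (h1.trans_lt ?_)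
    rw [ofReal_re]
    exact_mod_cast hσ
  exact (summable_jsCoeff_mul_rpow_neg_iff S α σ).mpr hsum

/-- The same conclusion in the shape of (5.3.3):
`∑_{(k, v)} |p_{k+1}(α v)|² / ((k+1) q_v^{(k+1)σ}) < ∞` for `σ > 1`. [folklore] -/
theorem summable_normSq_trace_of_realQuotient_of_rpow {S : Set (HeightOneSpectrum (𝓞 K))}
    {α : SatakeFamily K} {n : ℕ} {B : ℝ}
    (hb : ∀ v ∉ S, ∀ a ∈ α v, ‖a‖ ≤ (v.residueCard : ℝ) ^ B)
    (hcard : ∀ v ∉ S, Multiset.card (α v) ≤ n) {x₀ : ℝ}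
    (hq : ∀ σ₀ : ℝ, 1 < σ₀ → ∃ I A : ℂ → ℂ, DifferentiableOn ℂ I {s : ℂ | 1 < s.re} ∧
      DifferentiableOn ℂ A {s : ℂ | 1 < s.re} ∧ A σ₀ ≠ 0 ∧
        ∀ s : ℂ, 1 < s.re → x₀ < s.re → I s = A s * partialPairL S α (conjFamily α) s)
    {σ : ℝ} (hσ : 1 < σ) :
    Summable fun kv : ℕ × {v : HeightOneSpectrum (𝓞 K) // v ∉ S} =>
      ‖((α kv.2.1).map (· ^ (kv.1 + 1))).sum‖ ^ 2 /
        ((kv.1 + 1 : ℝ) * (kv.2.1.residueCard : ℝ) ^ ((kv.1 + 1 : ℝ) * σ)) :=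
  (summable_jsCoeff_mul_rpow_neg_of_realQuotient_of_rpow hb hcard hq hσ).congr fun i =>
    jsCoeff_mul_rpow_neg S α σ i

end RealQuotientSeries

section RealQuotient

variable {n : ℕ} {K : Type} [Field K] [NumberField K]
  {μ : Measure (AdelicGroupData.gl n K).automorphicQuotient}
  [(AdelicGroupData.gl n K).IsAutomorphicMeasure μ]

/-- **The Rankin–Selberg quotient representation of `L_S(s, π × π̄)` at real points** (the printed
proof of Jacquet–Shalika (1981), Lemma (5.2), p. 555, specialised to real `s₀`). For every (unitary)
cuspidal automorphic representation `Π` of `GL_n(𝔸_K)` there is a finite set `S₀` of finite places such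
that for every finite `S ⊇ S₀` and every Satake family `α` of `Π` off `S` there is an abscissa `x₀`
with: for every **real** `σ₀ > 1` there are functions `I`, `A` holomorphic on `re s > 1` with
`A(σ₀) ≠ 0` and `I(s) = A(s) · L_S(s, α × ᾱ)` (`partialPairL ↑S α (conjFamily α) s =
∏_{v ∉ S} det(1 - q_v^{-s} A_v ⊗ Ā_v)⁻¹`) whenever `re s > 1` and `re s > x₀`. In the source
`I = Ψ(s, W', W, Φ) = ∫ φ' φ E(·, Φ, s)` is the integral of two cusp forms against the mirabolic
Eisenstein series, holomorphic on `re s > 1` (§4), `A(s) = ∏_{v ∈ S} Ψ_v(s, W'_v, W_v, Φ_v)` is the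
product of the local integrals at the places of `S` (holomorphic there), the identity is the Euler
factorisation of §4 with the unramified computation of §2 on the half-plane (5.1.4) of absolute
convergence, and "given `s₀` we may choose `φ'`, `φ` and `Φ` so that `A(s₀) ≠ 0` (see §1 and §3).
Hence `L_S` is holomorphic at `s₀`" (p. 555; likewise Cogdell (2004), §2.3 and §4.1). The printed
statement is for *every* `s₀` with `re s₀ > 1`; only real `s₀` are recorded here, because (i) that
is all the proof of Thm. (5.3) consumes (`summable_normSq_trace_largeFinset_of_realQuotient`, via the
quotient form of Landau's lemma), and (ii) at a real `σ₀`, for `φ' = φ̄` and suitable `Φ ≥ 0`, the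
local integrals making up `A(σ₀)` are integrals of non-negative functions, so that `A(σ₀) > 0` needs
no local non-vanishing theory (their convergence on `re s > 1`, i.e. the holomorphy of `A`, is still
part of the statement).
Weaker than `JacquetShalika1981_continuation_partialPairL_conj`
(`JacquetShalika1981_realQuotient_of_continuation`: take `I = F`, `A = 1`).
[cite: JacquetShalikaAJM1981, Lemma (5.2), proof, p. 555] -/
def JacquetShalika1981_realQuotient_partialPairL_conj : Prop :=
  ∀ (P : CuspidalAutomorphicRepGL n K μ), ∃ S₀ : Finset (HeightOneSpectrum (𝓞 K)),
    ∀ ⦃S : Finset (HeightOneSpectrum (𝓞 K))⦄ ⦃α : SatakeFamily K⦄, S₀ ⊆ S →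
      IsSatakeFamilyOf P ↑S α → ∃ x₀ : ℝ, ∀ σ₀ : ℝ, 1 < σ₀ →
        ∃ I A : ℂ → ℂ, DifferentiableOn ℂ I {s : ℂ | 1 < s.re} ∧
          DifferentiableOn ℂ A {s : ℂ | 1 < s.re} ∧ A σ₀ ≠ 0 ∧
            ∀ s : ℂ, 1 < s.re → x₀ < s.re → I s = A s * partialPairL ↑S α (conjFamily α) s

/-- **Lemma (5.2) implies the real-quotient statement** (`I = F` the continuation, `A = 1`): the new
input is weaker than the named fact `JacquetShalika1981_continuation_partialPairL_conj`. [folklore] -/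
theorem JacquetShalika1981_realQuotient_of_continuation
    (h₅₂ : JacquetShalika1981_continuation_partialPairL_conj (μ := μ)) :
    JacquetShalika1981_realQuotient_partialPairL_conj (μ := μ) := by
  intro P
  obtain ⟨S₀, hS₀⟩ := h₅₂ P
  refine ⟨S₀, fun S α hS hα => ?_⟩
  obtain ⟨F, x₀, hF, hFeq⟩ := hS₀ hS hα
  refine ⟨x₀, fun σ₀ _ => ⟨F, fun _ => 1, hF, differentiableOn_const 1, one_ne_zero,
    fun s _ hs => ?_⟩⟩
  rw [one_mul, hFeq s hs]

/-- The real-quotient statement also follows from the complex "local quotients" hypothesis of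
`RankinSelbergContinuationGlue` (specialise `s₀` to real points). [folklore] -/
theorem JacquetShalika1981_realQuotient_of_local_quotients
    (h : ∀ P : CuspidalAutomorphicRepGL n K μ, ∃ S₀ : Finset (HeightOneSpectrum (𝓞 K)),
      ∀ ⦃S : Finset (HeightOneSpectrum (𝓞 K))⦄ ⦃α : SatakeFamily K⦄, S₀ ⊆ S →
        IsSatakeFamilyOf P ↑S α → ∃ x₀ : ℝ, ∀ s₀ : ℂ, 1 < s₀.re →
          ∃ I A : ℂ → ℂ, DifferentiableOn ℂ I {s : ℂ | 1 < s.re} ∧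
            DifferentiableOn ℂ A {s : ℂ | 1 < s.re} ∧ A s₀ ≠ 0 ∧
              ∀ s : ℂ, 1 < s.re → x₀ < s.re →
                I s = A s * partialPairL ↑S α (conjFamily α) s) :
    JacquetShalika1981_realQuotient_partialPairL_conj (μ := μ) := by
  intro P
  obtain ⟨S₀, hS₀⟩ := h P
  refine ⟨S₀, fun S α hS hα => ?_⟩
  obtain ⟨x₀, hx₀⟩ := hS₀ hS hα
  exact ⟨x₀, fun σ₀ hσ₀ => hx₀ σ₀ (by rwa [ofReal_re])⟩

/-- **(J) from the real-quotient input**: for `S ⊇ S₀` and a Satake family `α` of `Π` off `S`, the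
series (5.3.3) converges for `σ > 1`, by the quotient form of Landau's lemma at real points with the
trivial bound `IsSatakeFamilyOf.norm_le_rpow` (`B = n² + 1`) supplying the half-plane of absolute
convergence (`summable_normSq_trace_of_realQuotient_of_rpow`).
[cite: JacquetShalikaAJM1981, Thm. (5.3), proof, (5.3.3)–(5.3.4)] -/
theorem summable_normSq_trace_largeFinset_of_realQuotient
    (h : JacquetShalika1981_realQuotient_partialPairL_conj (μ := μ)) :
    summable_normSq_trace_largeFinset (μ := μ) := by
  intro P
  obtain ⟨S₀, hS₀⟩ := h P
  refine ⟨S₀, fun S α hS hα σ hσ => ?_⟩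
  obtain ⟨x₀, hq⟩ := hS₀ hS hα
  exact summable_normSq_trace_of_realQuotient_of_rpow (n := n) (B := (n : ℝ) ^ 2 + 1)
    (fun v hv a ha => hα.norm_le_rpow hv ha) (fun v hv => (hα.card_eq hv).le) hq hσ

/-- **`multipliable_L` from the real-quotient input** (Jacquet–Shalika's Thm. (5.3) for the full
Euler product of every standard `L`-function datum of a cuspidal `Π`, from the Rankin–Selberg
quotient representation of `L_S(s, π × π̄)` at real points only).
[cite: JacquetShalikaAJM1981, Thm. (5.3), Lemma (5.2)] -/
theorem StandardLFunctionData.multipliable_L_of_realQuotient {P : CuspidalAutomorphicRepGL n K μ}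
    (h : JacquetShalika1981_realQuotient_partialPairL_conj (μ := μ)) :
    StandardLFunctionData.multipliable_L (P := P) :=
  StandardLFunctionData.multipliable_L_of_largeFinset
    (summable_normSq_trace_largeFinset_of_realQuotient h)

/-- `absolutelyConvergent_partialStandardL` from the real-quotient input.
[cite: JacquetShalikaAJM1981, Thm. (5.3), Remark (5.4)] -/
theorem absolutelyConvergent_partialStandardL_of_realQuotient
    (h : JacquetShalika1981_realQuotient_partialPairL_conj (μ := μ)) :
    absolutelyConvergent_partialStandardL (μ := μ) :=
  absolutelyConvergent_partialStandardL_of_largeFinset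
    (summable_normSq_trace_largeFinset_of_realQuotient h)

/-- `multipliable_partialStandardL` from the real-quotient input.
[cite: JacquetShalikaAJM1981, Thm. (5.3)] -/
theorem multipliable_partialStandardL_of_realQuotient
    (h : JacquetShalika1981_realQuotient_partialPairL_conj (μ := μ)) :
    multipliable_partialStandardL (μ := μ) :=
  multipliable_partialStandardL_of_largeFinset (summable_normSq_trace_largeFinset_of_realQuotient h)

/-- The splitting `L_eq_partialStandardL_mul` from the real-quotient input. [folklore] -/
theorem StandardLFunctionData.L_eq_partialStandardL_mul_of_realQuotient
    {P : CuspidalAutomorphicRepGL n K μ}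
    (h : JacquetShalika1981_realQuotient_partialPairL_conj (μ := μ)) :
    StandardLFunctionData.L_eq_partialStandardL_mul (P := P) :=
  StandardLFunctionData.L_eq_partialStandardL_mul_of_largeFinset
    (summable_normSq_trace_largeFinset_of_realQuotient h)

end RealQuotient

end Literature.NumberTheory.Automorphic
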